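import Literature.NumberTheory.Automorphic.HeckeAlgebraPointEigenvector
import Mathlib.RingTheory.TensorProduct.IsBaseChangeHom
import Mathlib.RingTheory.TensorProduct.Finite
import Mathlib.RingTheory.Flat.Basic
import Mathlib.LinearAlgebra.TensorProduct.Tower
import HarnessLib

/-!
# Points of a commutative algebra of endomorphisms with values in an extension field

Topic `NumberTheory/Automorphic` (Hecke algebras); namespace `Literature.NumberTheory.Automorphic`;
theorems only, continuing `HeckeAlgebraPointEigenvector`.  The last step of Hida's control theorem
in consequence form for a `ℚ̄_p`-VALUED point ([Hida1994AIF, Thm. 3.2]; [KhareThorne2017, §6.5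
Lemma 6.17]: the Hecke algebra `h_κ(U; E)` is an `E`-algebra for a FINITE extension `E/ℚ_p`, the
point `x` takes values in `ℚ̄_p`): **for a commutative subalgebra `A ⊆ End_E(V)` of a
finite-dimensional `V` and an `E`-algebra homomorphism `x : A → K` into any extension field `K`,
there is a non-zero `w ∈ K ⊗_E V` with `(1 ⊗ a) w = x(a) w` for all `a ∈ A`**
(`exists_ne_zero_forall_baseChange_apply_eq_smul`).  Proof: `K ⊗_E A → End_K(K ⊗_E V)` is
injective (`tensorEnd_injective`: flatness of `K/E` and `IsBaseChange.end`), so the `K`-point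
`x_K = id ⊗ x` of `K ⊗_E A` descends to its (commutative) image, to which the case `K = E`
(`exists_ne_zero_forall_apply_eq_smul_of_algHom`) applies.

## References

* H. Hida, Ann. Inst. Fourier 44 (1994), §3 Thm. 3.2 (held). [Hida1994AIF]
* C. Khare, J. A. Thorne, Amer. J. Math. 139 (2017), §6.5 Lemma 6.17 (arXiv:1409.7007, held).
  [KhareThorne2017]
-/

noncomputable section

namespace Literature.NumberTheory.Automorphic

open TensorProduct

variable {E V : Type*} [Field E] [AddCommGroup V] [Module E V] (K : Type*) [Field K] [Algebra E K]

/-- For the standard base change `V → K ⊗_E V`, Mathlib's `IsBaseChange.endHom` is `baseChange`.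
[folklore] -/
theorem endHom_eq_baseChange (f : Module.End E V) :
    (TensorProduct.isBaseChange E V K).endHom f = f.baseChange K :=
  (TensorProduct.isBaseChange E V K).algHom_ext _ _ fun v => by
    rw [IsBaseChange.endHom_comp_apply]
    change _ = (LinearMap.baseChange K f) (1 ⊗ₜ[E] v)
    rw [LinearMap.baseChange_tmul]
    rfl

/-- **`K ⊗_E A → End_K(K ⊗_E V)`, `c ⊗ a ↦ c · (1 ⊗ a)`**, for a subalgebra `A ⊆ End_E(V)`, as a
`K`-algebra homomorphism. [folklore] -/
def tensorEnd (A : Subalgebra E (Module.End E V)) : K ⊗[E] A →ₐ[K] Module.End K (K ⊗[E] V) :=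
  Algebra.TensorProduct.lift (Algebra.ofId K _) ((Module.End.baseChangeHom E K V).comp A.val)
    fun c _ => Algebra.commute_algebraMap_left c _

/-- `tensorEnd` on pure tensors. [folklore] -/
@[simp]
theorem tensorEnd_tmul (A : Subalgebra E (Module.End E V)) (c : K) (a : A) :
    tensorEnd K A (c ⊗ₜ[E] a) = c • (a : Module.End E V).baseChange K := by
  rw [tensorEnd, Algebra.TensorProduct.lift_tmul, Algebra.ofId_apply, Algebra.algebraMap_eq_smul_one,
    smul_mul_assoc, one_mul]
  rfl

variable [FiniteDimensional E V]

/-- **`K ⊗_E A → End_K(K ⊗_E V)` is injective** (`K/E` flat and `K ⊗_E End_E(V) ≅ End_K(K ⊗_E V)`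
for finite-dimensional `V`). [folklore] -/
theorem tensorEnd_injective (A : Subalgebra E (Module.End E V)) : Function.Injective (tensorEnd K A) := by
  have hend := (TensorProduct.isBaseChange E V K).end
  -- the composite `K ⊗ A → K ⊗ End_E V ≃ End_K (K ⊗ V)` is `tensorEnd`
  have hfac : (tensorEnd K A).toLinearMap =
      hend.equiv.toLinearMap ∘ₗ (A.val.toLinearMap.baseChange K) := by
    refine TensorProduct.AlgebraTensorModule.ext fun c a => ?_
    simp only [AlgHom.toLinearMap_apply, tensorEnd_tmul, LinearMap.coe_comp, Function.comp_apply,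
      LinearEquiv.coe_coe, LinearMap.baseChange_tmul, IsBaseChange.equiv_tmul, endHom_eq_baseChange]
    rfl
  have h1 : Function.Injective (A.val.toLinearMap.baseChange K) :=
    Module.Flat.lTensor_preserves_injective_linearMap _ Subtype.val_injective
  have h : Function.Injective (tensorEnd K A).toLinearMap := by
    rw [hfac]
    exact hend.equiv.injective.comp h1
  exact h

/-- **A `K`-valued point of a commutative algebra of endomorphisms is the eigensystem of a non-zero
common eigenvector after base change to `K`.** [cite: Hida1994AIF, §3 Thm. 3.2]
[cite: KhareThorne2017, §6.5 Lemma 6.17] -/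
theorem exists_ne_zero_forall_baseChange_apply_eq_smul (A : Subalgebra E (Module.End E V))
    (hA : ∀ a b : A, Commute a b) (x : A →ₐ[E] K) :
    ∃ w : K ⊗[E] V, w ≠ 0 ∧ ∀ a : A, (a : Module.End E V).baseChange K w = x a • w := by
  classical
  -- the `K`-point `id ⊗ x` of `K ⊗_E A`
  let xK : K ⊗[E] A →ₐ[K] K :=
    Algebra.TensorProduct.lift (AlgHom.id K K) x fun c a => Commute.all c _
  have hxK : ∀ (c : K) (a : A), xK (c ⊗ₜ[E] a) = c * x a := fun c a => by
    simp only [xK, Algebra.TensorProduct.lift_tmul, AlgHom.id_apply]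
  -- descend along the injective `tensorEnd` to its image `B`
  let Φ := tensorEnd K A
  let e : (K ⊗[E] A) ≃ₐ[K] Φ.range := AlgEquiv.ofInjective Φ (tensorEnd_injective K A)
  let y : Φ.range →ₐ[K] K := xK.comp (e.symm : Φ.range →ₐ[K] K ⊗[E] A)
  -- the image is commutative
  have hcommA : ∀ s t : K ⊗[E] A, Φ s * Φ t = Φ t * Φ s := by
    intro s t
    rw [← map_mul, ← map_mul]
    congr 1
    induction s using TensorProduct.induction_on with
    | zero => rw [zero_mul, mul_zero]
    | tmul c a =>
      induction t using TensorProduct.induction_on with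
      | zero => rw [zero_mul, mul_zero]
      | tmul c' a' =>
        rw [Algebra.TensorProduct.tmul_mul_tmul, Algebra.TensorProduct.tmul_mul_tmul, mul_comm c c',
          (hA a a').eq]
      | add t₁ t₂ h₁ h₂ => rw [mul_add, add_mul, h₁, h₂]
    | add s₁ s₂ h₁ h₂ => rw [add_mul, mul_add, h₁, h₂]
  have hB : ∀ s t : Φ.range, Commute s t := by
    rintro ⟨_, s, rfl⟩ ⟨_, t, rfl⟩
    exact Subtype.ext (hcommA s t)
  obtain ⟨w, hw, hyw⟩ := exists_ne_zero_forall_apply_eq_smul_of_algHom Φ.range hB y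
  refine ⟨w, hw, fun a => ?_⟩
  have h := hyw ⟨Φ ((1 : K) ⊗ₜ[E] a), ⟨_, rfl⟩⟩
  have he : e.symm ⟨Φ ((1 : K) ⊗ₜ[E] a), ⟨_, rfl⟩⟩ = (1 : K) ⊗ₜ[E] a :=
    e.symm_apply_eq.2 (Subtype.ext (AlgEquiv.ofInjective_apply Φ (tensorEnd_injective K A) _)).symm
  have hy : y ⟨Φ ((1 : K) ⊗ₜ[E] a), ⟨_, rfl⟩⟩ = x a := by
    change xK (e.symm _) = x a
    rw [he, hxK, one_mul]
  rw [hy] at h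
  simpa only [Φ, tensorEnd_tmul, one_smul] using h

end Literature.NumberTheory.Automorphic
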